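import Mathlib
import HarnessLib
import Summits.HubbardSuperconductivity.HubbardSuperconductivity.Theorems.KLProgrammeKLRegimeSplitTwoLegCoreTExplicit
import Summits.HubbardSuperconductivity.HubbardSuperconductivity.Theorems.KLProgrammeKLRegimeSplitSymInterpExact
import Summits.HubbardSuperconductivity.HubbardSuperconductivity.Theorems.KLProgrammeKLRegimeSplitTwoLegCounterVertex
import Summits.HubbardSuperconductivity.HubbardSuperconductivity.Theorems.KLProgrammeKLRegimeSplitCutoffNumeralsTier1
import Summits.HubbardSuperconductivity.HubbardSuperconductivity.Theorems.KLProgrammeKLRegimeEngineV8DefsQ5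

/-!
# Route `KLProgramme` — gen-5 ENGINE child 19918, stub `stub_twoLeg_scale0`: the slot core `TwoLegCoreT … K 0` from the K-SEPARATED scale-0
# exports (counterterm vertex removed exactly; off-diagonal moments; aliasing sizes as hypotheses, `= 0` under the degree guard)

Cell `gate-hubbard-kl`, seat p1b (g7).  Supersedes `twoLegCoreT_zero_of_exports_explicit/_stub` (p493058/p493178), whose (E3a) fit was unsatisfiable
(memo `SCALE0-TWOLEG-EXPORTS.md` F1, evidence #25 on 19918).  With `G' := 𝒱^{(0)} − 𝒩_K = klEffectiveAction … K klE0 0 − counterQuadratic L M β K`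
(`klLocSelfEnergyRe…0 − K∘p = loc(G')`, `…TwoLegCounterVertex`) and the frame's interpolation error `F_a := evalM (symInterp L (K∘p)) − evalM K`:

* (E3a-T1) — `twoLegPieceFn_eval_zero_tier1_size_le_sep` with `mₖ = 2·(Mˢ₀ | Mˢ♯ₖ)(G')` (`twoLeg_scaleZero_sep_moments_of_counterSeparated`) and
  aliasing sizes `aₖ` (hypotheses; `X := 1110`);
* (E3c-T) — `frameLipschitzFnT_zero_of_responses_explicit` with the gradient `b₀ := 2Mˢ♯₁ + a₁` (`norm_fderiv_scaleZero_reading_le_sep`) and the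
  engine's response modulus `ρ₀` (hypothesis; see the memo's F2 on this clause);
* (E3d/e) — `twoLegSlopes_of_fieldStrength_of_gradient` with the K-separated gradient `2Mˢ♯₁ + a₁ + (4/3)·Gfr₁·U²`
  (`norm_iteratedFDeriv_one_frameShift_le_of_frameOK`: the ORDER-1 size of an admissible frame is `O(U²)`) and the time moment `Mᵗ` of `𝒱^{(0)}`.

* **`twoLegCoreT_zero_of_exports_sep`** (named thresholds `klCurveC3 R`/`klCurveU0 R`, generic `G Q`);
* **`twoLegCoreT_zero_of_exports_sep_stub5`** (`stub_twoLeg_scale0`'s literal binders, `G := klEngGeo3`, `Q := klEngQ5 P R`);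
* **`twoLegCoreT_zero_of_exports_sep_stub5_of_degree_le`** (the same with `aₖ = 0` for `K.degree ≤ L/2`).

Proofs only; nothing about the model is asserted.  References: BGM 2006 §2.4 (2.36) [cite: BenfattoGiulianiMastropietro2006].
-/

noncomputable section

namespace Summit.HubbardSuperconductivity.HubbardSuperconductivity.Theorems.KLRegimeSplit

set_option linter.dupNamespace false -- summit = problem name (single-conjunct summit), D-0017

open Real Finset
open Literature.MathematicalPhysics.QuantumLattice Literature.MathematicalPhysics.QuantumLattice.BandSectorCounting
open Literature.Probability.LatticeModels
open Summit.HubbardSuperconductivity.HubbardSuperconductivity.Theorems.DispersionFlow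
open Summit.HubbardSuperconductivity.HubbardSuperconductivity.Theorems.PerturbedFermiCurve
open Summit.HubbardSuperconductivity.HubbardSuperconductivity.Theorems.KLProgrammeLegKernels
open Summit.HubbardSuperconductivity.HubbardSuperconductivity.Theorems.TwoLegFourier
open Summit.HubbardSuperconductivity.HubbardSuperconductivity.Theorems.EngineV8

variable {L M : ℕ} [NeZero L] [NeZero M]

/-! ## §1 Two small inputs: the order-1 size of an admissible frame; the K-separated gradients -/

omit [NeZero M] in
/-- **The ORDER-1 size of an admissible frame is `O(U²)`**: `‖D¹(frameShift K)(p)‖ ≤ (4/3)·Gfr₁·U²` (pieces `Gfr₁·U²·4^{−n}`, geometric sum). -/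
theorem norm_iteratedFDeriv_one_frameShift_le_of_frameOK {R : RenConsts} (hR : ∀ j, 0 ≤ R.Gfr j) {U : ℝ} {N : ℕ} {μ : ℝ}
    {K : TrigPolyC4v} (hK : FrameOK R U N μ K) (p : Momentum) :
    ‖iteratedFDeriv ℝ 1 (frameShift K) p‖ ≤ 4 / 3 * R.Gfr 1 * U ^ 2 := by
  obtain ⟨-, Kp, hsum, hS⟩ := hK
  have hfs : frameShift K = fun q => ∑ n ∈ range (N + 1), (fun q => -evalM (Kp n) q) q := by
    funext q
    simp only [frameShift, evalM, hsum (WithLp.ofLp q), Finset.sum_neg_distrib]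
  have hD : ‖iteratedFDeriv ℝ 1 (frameShift K) p‖ ≤ ∑ n ∈ range (N + 1), R.Gfr 1 * U ^ 2 * ((4 : ℝ) ^ n)⁻¹ := by
    rw [hfs, iteratedFDeriv_fun_sum_apply fun n _ => ((contDiff_evalM (Kp n)).neg).contDiffAt]
    refine (norm_sum_le _ _).trans (sum_le_sum fun n hn => ?_)
    have hn' : n ≤ N := Nat.lt_succ_iff.mp (mem_range.mp hn)
    have h := hS n hn' 1 (by norm_num) p
    rw [show (fun q => -evalM (Kp n) q) = -evalM (Kp n) from rfl, iteratedFDeriv_neg_apply, norm_neg]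
    refine h.trans (le_of_eq ?_)
    rw [uPow, if_neg one_ne_zero, show (((1 : ℕ) : ℤ) - 2) * (n : ℤ) = -(n : ℤ) by ring, zpow_neg, zpow_natCast]
  refine hD.trans ?_
  rw [← mul_sum]
  have hgeo : ∑ n ∈ range (N + 1), ((4 : ℝ) ^ n)⁻¹ ≤ 4 / 3 := by
    have h := geom_sum_Ico_le_of_lt_one (show (0 : ℝ) ≤ 1 / 4 by norm_num) (show (1 : ℝ) / 4 < 1 by norm_num) (m := 0) (n := N + 1)
    simp only [Finset.range_eq_Ico, pow_zero] at h ⊢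
    have h' : ∑ i ∈ Ico 0 (N + 1), ((4 : ℝ) ^ i)⁻¹ = ∑ i ∈ Ico 0 (N + 1), (1 / 4 : ℝ) ^ i :=
      sum_congr rfl fun i _ => by rw [one_div, inv_pow]
    rw [h']
    exact h.trans (by norm_num)
  have h0 : 0 ≤ R.Gfr 1 * U ^ 2 := mul_nonneg (hR 1) (sq_nonneg U)
  nlinarith

/-- **K-separated gradients of the scale-0 reading functions**: with `g := klLocSelfEnergyRe…0 − K∘p`, `F_a := evalM(symInterp L (K∘p)) − evalM K`,
`m₁ ≥ ‖D¹ evalM (symInterp L g)‖`, `a₁ ≥ ‖D¹F_a‖`: (i) `‖fderiv (evalM S₀ − evalM K) q‖ ≤ m₁ + a₁`; (ii) `‖fderiv (evalM S₀) q‖ ≤ m₁ + a₁ + ‖D¹(frameShift K) q‖`. -/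
theorem norm_fderiv_scaleZero_reading_le_sep {β U μ : ℝ} {K : TrigPolyC4v} {m₁ a₁ : ℝ}
    (hm : ∀ p : Momentum, ‖iteratedFDeriv ℝ 1
      (evalM (symInterp L (fun q => klLocSelfEnergyRe L M β U μ K 0 q - K.eval (latticeMomentum L q)))) p‖ ≤ m₁)
    (ha : ∀ p : Momentum, ‖iteratedFDeriv ℝ 1
      (fun p : Momentum => evalM (symInterp L (fun q => K.eval (latticeMomentum L q))) p - evalM K p) p‖ ≤ a₁) (q : Momentum) :
    ‖fderiv ℝ (fun q : Momentum => evalM (symInterp L (klLocSelfEnergyRe L M β U μ K 0)) q - evalM K q) q‖ ≤ m₁ + a₁ ∧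
    ‖fderiv ℝ (evalM (symInterp L (klLocSelfEnergyRe L M β U μ K 0))) q‖ ≤ m₁ + a₁ + ‖iteratedFDeriv ℝ 1 (frameShift K) q‖ := by
  set Fg : Momentum → ℝ := evalM (symInterp L (fun q => klLocSelfEnergyRe L M β U μ K 0 q - K.eval (latticeMomentum L q))) with hFg
  set Fa : Momentum → ℝ := fun p => evalM (symInterp L (fun q => K.eval (latticeMomentum L q))) p - evalM K p with hFa
  have hFgc : ∀ {k : WithTop ℕ∞}, ContDiff ℝ k Fg := fun {k} => contDiff_evalM _
  have hFac : ∀ {k : WithTop ℕ∞}, ContDiff ℝ k Fa := fun {k} => (contDiff_evalM _).sub (contDiff_evalM K)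
  have hsplit : (fun q : Momentum => evalM (symInterp L (klLocSelfEnergyRe L M β U μ K 0)) q - evalM K q) = Fg + Fa := by
    funext p
    simp only [hFg, hFa, Pi.add_apply, evalM_apply]
    rw [show (klLocSelfEnergyRe L M β U μ K 0) = fun q => (klLocSelfEnergyRe L M β U μ K 0 q - K.eval (latticeMomentum L q)) +
      K.eval (latticeMomentum L q) from funext fun q => by ring]
    rw [eval_symInterp_add]
    ring
  have h1 : ‖fderiv ℝ (fun q : Momentum => evalM (symInterp L (klLocSelfEnergyRe L M β U μ K 0)) q - evalM K q) q‖ ≤ m₁ + a₁ := by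
    rw [← norm_iteratedFDeriv_one, hsplit, iteratedFDeriv_add_apply (hFgc.contDiffAt.of_le le_top) (hFac.contDiffAt.of_le le_top)]
    exact (norm_add_le _ _).trans (add_le_add (hm q) (ha q))
  refine ⟨h1, ?_⟩
  have hS : evalM (symInterp L (klLocSelfEnergyRe L M β U μ K 0)) =
      (fun q : Momentum => evalM (symInterp L (klLocSelfEnergyRe L M β U μ K 0)) q - evalM K q) + (-frameShift K) := by
    funext p
    simp only [Pi.add_apply, Pi.neg_apply, frameShift, evalM]
    ring
  have hFc : ∀ {k : WithTop ℕ∞}, ContDiff ℝ k (fun q : Momentum => evalM (symInterp L (klLocSelfEnergyRe L M β U μ K 0)) q - evalM K q) :=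
    fun {k} => (contDiff_evalM _).sub (contDiff_evalM K)
  have hKc : ∀ {k : WithTop ℕ∞}, ContDiff ℝ k (-frameShift K) := fun {k} => by
    have : frameShift K = -evalM K := by funext p; simp [frameShift, evalM]
    rw [this, neg_neg]; exact contDiff_evalM K
  rw [← norm_iteratedFDeriv_one, hS, iteratedFDeriv_add_apply (hFc.contDiffAt.of_le le_top) (hKc.contDiffAt.of_le le_top),
    iteratedFDeriv_neg_apply]
  refine (norm_add_le _ _).trans ?_
  rw [norm_neg, norm_iteratedFDeriv_one]
  exact add_le_add h1 le_rfl

/-! ## §2 The K-separated scale-0 `TwoLegCoreT` -/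

/-- **`TwoLegCoreT hist … K 0` from the K-SEPARATED scale-0 exports, NAMED thresholds** (`G' = 𝒱^{(0)} − 𝒩_K`): zeroth moment `Mˢ₀` and
off-diagonal moments `Mˢ♯₁, Mˢ♯₂` of `G'`'s unsectorised two-leg kernels, aliasing sizes `a₀,a₁,a₂` of the frame, the time moment `Mᵗ` of `𝒱^{(0)}`,
the (E3c) response modulus `ρ₀`, and four fits (`X = 1110` baked in). -/
theorem twoLegCoreT_zero_of_exports_sep {R : RenConsts} (hR : ∀ j, 0 ≤ R.Gfr j) {c : ℝ} (hc : 0 < c)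
    (hcle : c ≤ klCurveC3 R) {U : ℝ} (hU : 0 < U) (hUle : U ≤ klCurveU0 R) {β : ℝ} (hβmin : klBetaMin ≤ β)
    (hβc : β ≤ Real.exp (c / U ^ 2)) {μ : ℝ} (hμ : μ ∈ klWindowC) {K : TrigPolyC4v} (hK : FrameOK R U (nScales β) μ K)
    (hist : TrigPolyC4v → ℕ → Prop) (G : GeoConsts) (P : SplitConsts) (Q : EngConsts)
    -- (E3a) K-separated exports: moments of `G' = 𝒱^{(0)} − 𝒩_K`
    {Ms0 : ℝ} {Msh : ℕ → ℝ}
    (hMs0 : ∀ (σ : Fin 2) (x₀ : SpaceTimeIdx L M), imagTimeWeight β M *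
      ∑ x ∈ (univ : Finset (Fin 2 → SpaceTimeIdx L M)).filter (fun x => x 0 = x₀),
        (1 + ((((x 1).2 - (x 0).2) 0).valMinAbs.natAbs : ℝ) + ((((x 1).2 - (x 0).2) 1).valMinAbs.natAbs : ℝ)) ^ 0 *
          ‖sectorisedKernel L M β (trivialMultiplier L M)
              (klEffectiveAction L M β U μ K klE0 0 - counterQuadratic L M β K) 2 (![((0, σ), 0), ((0, σ), 1)] : Fin 2 → SectorLeg 1) x‖ ≤ Ms0)
    (hMsh : ∀ k, 1 ≤ k → k ≤ 2 → ∀ (σ : Fin 2) (x₀ : SpaceTimeIdx L M), imagTimeWeight β M *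
      ∑ x ∈ (univ : Finset (Fin 2 → SpaceTimeIdx L M)).filter (fun x => x 0 = x₀ ∧ (x 1).2 ≠ (x 0).2),
        (1 + ((((x 1).2 - (x 0).2) 0).valMinAbs.natAbs : ℝ) + ((((x 1).2 - (x 0).2) 1).valMinAbs.natAbs : ℝ)) ^ k *
          ‖sectorisedKernel L M β (trivialMultiplier L M)
              (klEffectiveAction L M β U μ K klE0 0 - counterQuadratic L M β K) 2 (![((0, σ), 0), ((0, σ), 1)] : Fin 2 → SectorLeg 1) x‖ ≤ Msh k)
    -- aliasing sizes of the frame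
    {a : ℕ → ℝ}
    (ha : ∀ k ≤ 2, ∀ p : Momentum, ‖iteratedFDeriv ℝ k
      (fun p : Momentum => evalM (symInterp L (fun q => K.eval (latticeMomentum L q))) p - evalM K p) p‖ ≤ a k)
    (hfitS : ∀ j ≤ 2, (if j = 0 then 2 * Ms0 + a 0 else 0) +
      (j.factorial : ℝ) ^ 2 * (2 * j.factorial * 1110 * 200 ^ j) *
        (if j = 0 then 2 * (2 * Ms0 + a 0) else
          (2 * π + 1) * ((2 * Msh 1 + a 1) * klCurveD1) +
            (if j = 2 then (2 * Msh 2 + a 2) * klCurveD1 ^ 2 + (2 * Msh 1 + a 1) * klCurveD2 else 0)) *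
        (4 + max 1 (((j - 1).factorial : ℝ) / (8 / 5))) ^ j ≤ twoLegBar G Q U j 0)
    -- (E3c) response modulus
    {ρ₀ : ℝ}
    (hr₀ : ∀ K' : TrigPolyC4v, FrameOK R U (klTempScaleIdx β klE0) μ K' → ∀ θ : ℝ,
      |((symInterp L (klLocSelfEnergyRe L M β U μ K 0)).eval (klFermiPoint μ K' θ) - K.eval (klFermiPoint μ K' θ)) -
        ((symInterp L (klLocSelfEnergyRe L M β U μ K' 0)).eval (klFermiPoint μ K' θ) - K'.eval (klFermiPoint μ K' θ))| ≤
        ρ₀ * frameDist K K')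
    (hfitL : ρ₀ + (2 * Msh 1 + a 1) / klCurveD ≤ lipBar G Q U 0)
    -- (E3d) time moment of `𝒱^{(0)}`
    {Mt : ℝ}
    (hMt : ∀ (σ : Fin 2) (x₀ : SpaceTimeIdx L M), imagTimeWeight β M *
      ∑ x ∈ (univ : Finset (Fin 2 → SpaceTimeIdx L M)).filter (fun x => x 0 = x₀),
        imagTimeWeight β M * (circDist (2 * M) (x 0).1.val (x 1).1.val : ℝ) *
          ‖sectorisedKernel L M β (trivialMultiplier L M) (klEffectiveAction L M β U μ K klE0 0) 2
            (![((0, σ), 0), ((0, σ), 1)] : Fin 2 → SectorLeg 1) x‖ ≤ Mt)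
    (hfit1 : 2 * Msh 1 + a 1 + 4 / 3 * R.Gfr 1 * U ^ 2 ≤ R.cz * |U| * (cDtmin (-1.2) (-0.05) / 2)) (hfit2 : 2 * Mt ≤ R.cz * |U|) :
    TwoLegCoreT L M hist G P Q R β U μ K 0 := by
  have ha' : (-4 : ℝ) < -1.1 := by norm_num
  have hab : (-1.1 : ℝ) ≤ -0.1 := by norm_num
  have hb : (-0.1 : ℝ) < 0 := by norm_num
  obtain ⟨hAf, hA20, hADt, -, ⟨hlo, hhi⟩, -, -⟩ := frame_sizes_of_frameOK_explicit hR hc hcle hU hUle hβmin hβc hμ hK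
  have hβ : 0 < β := lt_of_lt_of_le (by unfold klBetaMin; norm_num) hβmin
  -- the K-separated momentum-side sizes
  set m : ℕ → ℝ := fun k => 2 * (if k = 0 then Ms0 else Msh k) with hmdef
  have hm : ∀ k ≤ 2, ∀ q : Momentum, ‖iteratedFDeriv ℝ k
      (evalM (symInterp L (fun p => klLocSelfEnergyRe L M β U μ K 0 p - K.eval (latticeMomentum L p)))) q‖ ≤ m k :=
    twoLeg_scaleZero_sep_moments_of_counterSeparated hβ U μ K hMs0 hMsh
  have hm0 : m 0 = 2 * Ms0 := by simp [hmdef]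
  have hm1 : m 1 = 2 * Msh 1 := by simp [hmdef]
  have hm2 : m 2 = 2 * Msh 2 := by simp [hmdef]
  have hgrad := fun q => norm_fderiv_scaleZero_reading_le_sep (L := L) (M := M) (hm 1 (by norm_num)) (ha 1 (by norm_num)) q
  have hb₀ : 0 ≤ 2 * Msh 1 + a 1 := by rw [← hm1]; exact (norm_nonneg _).trans (hgrad 0).1
  have h0 : ContDiff ℝ 4 (klLocalPart L M β U μ K 0) := contDiff_klLocalPart (bandBounds ha' hab hb) hAf hADt hlo hhi L M β U 0
  have hKc : ContDiff ℝ 4 (fun θ => K.eval (klFermiPoint μ K θ)) := contDiff_eval_klFermiPoint (bandBounds ha' hab hb) hAf hADt hlo hhi K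
  refine ⟨⟨?_, fun j hj q => ?_⟩, ?_, ?_⟩
  · have hP := klTwoLegPieceFn_eval_zero (L := L) (M := M) β U μ K h0.continuous hKc.continuous
    have hδ : ContDiff ℝ (4 : ℕ∞) (fun θ => klLocalPart L M β U μ K 0 θ - K.eval (klFermiPoint μ K θ)) := by
      exact_mod_cast h0.sub hKc
    have hper : Function.Periodic (fun θ => klLocalPart L M β U μ K 0 θ - K.eval (klFermiPoint μ K θ)) (2 * π) := fun θ => by
      simp only [klLocalPart_periodic β U μ K 0 θ, frameOnCurve_periodic μ K θ]
    exact_mod_cast contDiff_onM_piece hP hδ hper hμ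
  · have h := twoLegPieceFn_eval_zero_tier1_size_le_sep (L := L) (M := M) hR hc hcle hU hUle hβmin hβc hμ hK hm ha hj
      (fun l hl x => norm_iteratedFDeriv_salmhoferCutoff_le_of_le_two (hl.trans hj) x) q
    rw [hm0, hm1, hm2] at h
    exact h.trans (hfitS j hj)
  · exact frameLipschitzFnT_zero_of_responses_explicit (L := L) (M := M) hR hc hcle hU hUle hβmin hβc hμ hK hist G Q hb₀
      (fun q => (hgrad q).1) hr₀ hfitL
  · -- (E3d/e) with the K-separated gradient
    have haw : (-4 : ℝ) < -1.2 := by norm_num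
    have habw : (-1.2 : ℝ) ≤ -0.05 := by norm_num
    have hbw : (-0.05 : ℝ) < 0 := by norm_num
    set B := bandBounds haw habw hbw with hBdef
    have hBD : B.Dtmin = cDtmin (-1.2) (-0.05) := rfl
    have hAfw : ∀ p : Momentum, ∀ j ≤ 2, ‖iteratedFDeriv ℝ j (frameShift K) p‖ ≤
        2 * R.Gfr 0 * |U| + 2 * R.Gfr 1 * U ^ 2 + R.Gfr 2 * (c / Real.log 4) := fun p j hj =>
      norm_iteratedFDeriv_frameShift_le_of_frameOK_regime hR hc.le hβmin hβc hK p hj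
    obtain ⟨hA20w, hADtw, hhalf⟩ := two_frameSize_lt_cDtmin_wide hR hc.le hcle hU hUle
    have hADt' : 2 * (2 * R.Gfr 0 * |U| + 2 * R.Gfr 1 * U ^ 2 + R.Gfr 2 * (c / Real.log 4)) < B.Dtmin := by rw [hBD]; exact hADtw
    obtain ⟨hloΛ, hhiΛ⟩ := klWindowC_shell_margin hμ hA20w (klScale_klE0_le_klE0 0)
    have hczU : 0 ≤ R.cz * |U| := by
      by_contra hneg
      have hneg' : R.cz * |U| < 0 := lt_of_not_ge hneg
      have : R.cz * |U| * (cDtmin (-1.2) (-0.05) / 2) < 0 := mul_neg_of_neg_of_pos hneg' (by linarith [cDtmin_wide_ge])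
      have h13 : 0 ≤ 4 / 3 * R.Gfr 1 * U ^ 2 := by have := hR 1; positivity
      linarith
    set bS : ℝ := 2 * Msh 1 + a 1 + 4 / 3 * R.Gfr 1 * U ^ 2 with hbS
    have hbS0 : 0 ≤ bS := by have := hR 1; positivity
    have hgradS : ∀ q : Momentum, ‖fderiv ℝ (evalM (symInterp L (klLocSelfEnergyRe L M β U μ K 0))) q‖ ≤ bS := fun q => by
      have h := (hgrad q).2
      rw [hm1] at h
      exact h.trans (by rw [hbS]; linarith [norm_iteratedFDeriv_one_frameShift_le_of_frameOK hR hK q])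
    have hb' : bS ≤ R.cz * |U| * (B.Dtmin - 2 * (2 * R.Gfr 0 * |U| + 2 * R.Gfr 1 * U ^ 2 + R.Gfr 2 * (c / Real.log 4))) :=
      hfit1.trans (mul_le_mul_of_nonneg_left (by rw [hBD]; exact hhalf) hczU)
    refine twoLegSlopes_of_fieldStrength_of_gradient B hAfw hADt' hloΛ hhiΛ (selfEnergySymmetric_all L M β U μ K 0) ?_ hbS0 hgradS hb'
    intro k _
    exact (abs_klFieldStrength_sub_one_le_of_time_moment hβ U μ K 0 k hMt).trans hfit2

/-! ## §3 Stub-keyed corollaries (skeleton 26ce2d93b9f90451: `G := klEngGeo3`, `Q := klEngQ5 P R`) -/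

/-- **Stub-keyed, K-separated scale-0 `TwoLegCoreT`** in `stub_twoLeg_scale0`'s literal binders (`R.WF2`, `c ≤ klEngC₃3 P R`, `U ≤ klEngU₀3 P R c`). -/
theorem twoLegCoreT_zero_of_exports_sep_stub5 (P : SplitConsts) {R : RenConsts} (hRW : R.WF2) {c : ℝ} (hc : 0 < c)
    (hcle : c ≤ klEngC₃3 P R) {U : ℝ} (hU : 0 < U) (hUle : U ≤ klEngU₀3 P R c) {β : ℝ} (hβmin : klBetaMin ≤ β)
    (hβc : β ≤ Real.exp (c / U ^ 2)) {μ : ℝ} (hμ : μ ∈ klWindowC) {K : TrigPolyC4v} (hK : FrameOK R U (nScales β) μ K)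
    (hist : TrigPolyC4v → ℕ → Prop)
    {Ms0 : ℝ} {Msh : ℕ → ℝ}
    (hMs0 : ∀ (σ : Fin 2) (x₀ : SpaceTimeIdx L M), imagTimeWeight β M *
      ∑ x ∈ (univ : Finset (Fin 2 → SpaceTimeIdx L M)).filter (fun x => x 0 = x₀),
        (1 + ((((x 1).2 - (x 0).2) 0).valMinAbs.natAbs : ℝ) + ((((x 1).2 - (x 0).2) 1).valMinAbs.natAbs : ℝ)) ^ 0 *
          ‖sectorisedKernel L M β (trivialMultiplier L M)
              (klEffectiveAction L M β U μ K klE0 0 - counterQuadratic L M β K) 2 (![((0, σ), 0), ((0, σ), 1)] : Fin 2 → SectorLeg 1) x‖ ≤ Ms0)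
    (hMsh : ∀ k, 1 ≤ k → k ≤ 2 → ∀ (σ : Fin 2) (x₀ : SpaceTimeIdx L M), imagTimeWeight β M *
      ∑ x ∈ (univ : Finset (Fin 2 → SpaceTimeIdx L M)).filter (fun x => x 0 = x₀ ∧ (x 1).2 ≠ (x 0).2),
        (1 + ((((x 1).2 - (x 0).2) 0).valMinAbs.natAbs : ℝ) + ((((x 1).2 - (x 0).2) 1).valMinAbs.natAbs : ℝ)) ^ k *
          ‖sectorisedKernel L M β (trivialMultiplier L M)
              (klEffectiveAction L M β U μ K klE0 0 - counterQuadratic L M β K) 2 (![((0, σ), 0), ((0, σ), 1)] : Fin 2 → SectorLeg 1) x‖ ≤ Msh k)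
    {a : ℕ → ℝ}
    (ha : ∀ k ≤ 2, ∀ p : Momentum, ‖iteratedFDeriv ℝ k
      (fun p : Momentum => evalM (symInterp L (fun q => K.eval (latticeMomentum L q))) p - evalM K p) p‖ ≤ a k)
    (hfitS : ∀ j ≤ 2, (if j = 0 then 2 * Ms0 + a 0 else 0) +
      (j.factorial : ℝ) ^ 2 * (2 * j.factorial * 1110 * 200 ^ j) *
        (if j = 0 then 2 * (2 * Ms0 + a 0) else
          (2 * π + 1) * ((2 * Msh 1 + a 1) * klCurveD1) +
            (if j = 2 then (2 * Msh 2 + a 2) * klCurveD1 ^ 2 + (2 * Msh 1 + a 1) * klCurveD2 else 0)) *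
        (4 + max 1 (((j - 1).factorial : ℝ) / (8 / 5))) ^ j ≤ twoLegBar klEngGeo3 (klEngQ5 P R) U j 0)
    {ρ₀ : ℝ}
    (hr₀ : ∀ K' : TrigPolyC4v, FrameOK R U (klTempScaleIdx β klE0) μ K' → ∀ θ : ℝ,
      |((symInterp L (klLocSelfEnergyRe L M β U μ K 0)).eval (klFermiPoint μ K' θ) - K.eval (klFermiPoint μ K' θ)) -
        ((symInterp L (klLocSelfEnergyRe L M β U μ K' 0)).eval (klFermiPoint μ K' θ) - K'.eval (klFermiPoint μ K' θ))| ≤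
        ρ₀ * frameDist K K')
    (hfitL : ρ₀ + (2 * Msh 1 + a 1) / klCurveD ≤ lipBar klEngGeo3 (klEngQ5 P R) U 0)
    {Mt : ℝ}
    (hMt : ∀ (σ : Fin 2) (x₀ : SpaceTimeIdx L M), imagTimeWeight β M *
      ∑ x ∈ (univ : Finset (Fin 2 → SpaceTimeIdx L M)).filter (fun x => x 0 = x₀),
        imagTimeWeight β M * (circDist (2 * M) (x 0).1.val (x 1).1.val : ℝ) *
          ‖sectorisedKernel L M β (trivialMultiplier L M) (klEffectiveAction L M β U μ K klE0 0) 2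
            (![((0, σ), 0), ((0, σ), 1)] : Fin 2 → SectorLeg 1) x‖ ≤ Mt)
    (hfit1 : 2 * Msh 1 + a 1 + 4 / 3 * R.Gfr 1 * U ^ 2 ≤ R.cz * |U| * (cDtmin (-1.2) (-0.05) / 2)) (hfit2 : 2 * Mt ≤ R.cz * |U|) :
    TwoLegCoreT L M hist klEngGeo3 P (klEngQ5 P R) R β U μ K 0 :=
  have hR : ∀ j, 0 ≤ R.Gfr j := hRW.1.2.2
  twoLegCoreT_zero_of_exports_sep (L := L) (M := M) hR hc (hcle.trans (klEngC₃3_le_klCurveC3 P hR)) hU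
    (hUle.trans (klEngU₀3_le_klCurveU0 P hR c)) hβmin hβc hμ hK hist klEngGeo3 P (klEngQ5 P R) hMs0 hMsh ha hfitS hr₀ hfitL hMt hfit1 hfit2

/-- **Stub-keyed, K-separated scale-0 `TwoLegCoreT` for frames of degree `≤ L/2`**: no aliasing sizes (`aₖ = 0`, `…SymInterpExact`). -/
theorem twoLegCoreT_zero_of_exports_sep_stub5_of_degree_le (P : SplitConsts) {R : RenConsts} (hRW : R.WF2) {c : ℝ} (hc : 0 < c)
    (hcle : c ≤ klEngC₃3 P R) {U : ℝ} (hU : 0 < U) (hUle : U ≤ klEngU₀3 P R c) {β : ℝ} (hβmin : klBetaMin ≤ β)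
    (hβc : β ≤ Real.exp (c / U ^ 2)) {μ : ℝ} (hμ : μ ∈ klWindowC) {K : TrigPolyC4v} (hK : FrameOK R U (nScales β) μ K)
    (hdeg : K.degree ≤ L / 2) (hist : TrigPolyC4v → ℕ → Prop)
    {Ms0 : ℝ} {Msh : ℕ → ℝ}
    (hMs0 : ∀ (σ : Fin 2) (x₀ : SpaceTimeIdx L M), imagTimeWeight β M *
      ∑ x ∈ (univ : Finset (Fin 2 → SpaceTimeIdx L M)).filter (fun x => x 0 = x₀),
        (1 + ((((x 1).2 - (x 0).2) 0).valMinAbs.natAbs : ℝ) + ((((x 1).2 - (x 0).2) 1).valMinAbs.natAbs : ℝ)) ^ 0 *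
          ‖sectorisedKernel L M β (trivialMultiplier L M)
              (klEffectiveAction L M β U μ K klE0 0 - counterQuadratic L M β K) 2 (![((0, σ), 0), ((0, σ), 1)] : Fin 2 → SectorLeg 1) x‖ ≤ Ms0)
    (hMsh : ∀ k, 1 ≤ k → k ≤ 2 → ∀ (σ : Fin 2) (x₀ : SpaceTimeIdx L M), imagTimeWeight β M *
      ∑ x ∈ (univ : Finset (Fin 2 → SpaceTimeIdx L M)).filter (fun x => x 0 = x₀ ∧ (x 1).2 ≠ (x 0).2),
        (1 + ((((x 1).2 - (x 0).2) 0).valMinAbs.natAbs : ℝ) + ((((x 1).2 - (x 0).2) 1).valMinAbs.natAbs : ℝ)) ^ k *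
          ‖sectorisedKernel L M β (trivialMultiplier L M)
              (klEffectiveAction L M β U μ K klE0 0 - counterQuadratic L M β K) 2 (![((0, σ), 0), ((0, σ), 1)] : Fin 2 → SectorLeg 1) x‖ ≤ Msh k)
    (hfitS : ∀ j ≤ 2, (if j = 0 then 2 * Ms0 else 0) +
      (j.factorial : ℝ) ^ 2 * (2 * j.factorial * 1110 * 200 ^ j) *
        (if j = 0 then 2 * (2 * Ms0) else
          (2 * π + 1) * (2 * Msh 1 * klCurveD1) + (if j = 2 then 2 * Msh 2 * klCurveD1 ^ 2 + 2 * Msh 1 * klCurveD2 else 0)) *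
        (4 + max 1 (((j - 1).factorial : ℝ) / (8 / 5))) ^ j ≤ twoLegBar klEngGeo3 (klEngQ5 P R) U j 0)
    {ρ₀ : ℝ}
    (hr₀ : ∀ K' : TrigPolyC4v, FrameOK R U (klTempScaleIdx β klE0) μ K' → ∀ θ : ℝ,
      |((symInterp L (klLocSelfEnergyRe L M β U μ K 0)).eval (klFermiPoint μ K' θ) - K.eval (klFermiPoint μ K' θ)) -
        ((symInterp L (klLocSelfEnergyRe L M β U μ K' 0)).eval (klFermiPoint μ K' θ) - K'.eval (klFermiPoint μ K' θ))| ≤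
        ρ₀ * frameDist K K')
    (hfitL : ρ₀ + 2 * Msh 1 / klCurveD ≤ lipBar klEngGeo3 (klEngQ5 P R) U 0)
    {Mt : ℝ}
    (hMt : ∀ (σ : Fin 2) (x₀ : SpaceTimeIdx L M), imagTimeWeight β M *
      ∑ x ∈ (univ : Finset (Fin 2 → SpaceTimeIdx L M)).filter (fun x => x 0 = x₀),
        imagTimeWeight β M * (circDist (2 * M) (x 0).1.val (x 1).1.val : ℝ) *
          ‖sectorisedKernel L M β (trivialMultiplier L M) (klEffectiveAction L M β U μ K klE0 0) 2
            (![((0, σ), 0), ((0, σ), 1)] : Fin 2 → SectorLeg 1) x‖ ≤ Mt)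
    (hfit1 : 2 * Msh 1 + 4 / 3 * R.Gfr 1 * U ^ 2 ≤ R.cz * |U| * (cDtmin (-1.2) (-0.05) / 2)) (hfit2 : 2 * Mt ≤ R.cz * |U|) :
    TwoLegCoreT L M hist klEngGeo3 P (klEngQ5 P R) R β U μ K 0 := by
  refine twoLegCoreT_zero_of_exports_sep_stub5 (L := L) (M := M) P hRW hc hcle hU hUle hβmin hβc hμ hK hist hMs0 hMsh (a := fun _ => 0)
    (fun k _ p => by rw [iteratedFDeriv_symInterp_latticeValues_sub_eq_zero L K hdeg k p, norm_zero]) (fun j hj => ?_) hr₀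
    (by simpa only [add_zero] using hfitL) hMt (by simpa only [add_zero] using hfit1) hfit2
  simpa only [add_zero] using hfitS j hj

end Summit.HubbardSuperconductivity.HubbardSuperconductivity.Theorems.KLRegimeSplit

end
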